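/-
Copyright (c) 2026 the pub-hodgecm-mathlib formalisation cell (harness21).  Prover seat hodgecm-mathlib-K2E3-p29 (g2): Track B «K2-LIT»,
hLiu418 = stmt-HodgeConjecture-24832; LEAD F0P6-plan (g14) BATCH #87 (1) «(K1a-3)», line lead K2E5-p16 (g8), file (K1a-3)-S (the TWISTED rank-one stage).
-/
import Summits.HodgeConjecture.HodgeConjecture.Theorems.K2LiuRankOneStage                -- ★ B7-S `exists_level_and_reps`, `integrable_of_letters` (+ ★ B3, ★ B5a∕B5b)
import Summits.HodgeConjecture.HodgeConjecture.Theorems.K2LiuShellVanishingByAveraging     -- ★ F1 `setIntegral_eq_zero_of_translate`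
import Summits.HodgeConjecture.HodgeConjecture.Theorems.K2LiuAddCharTrivialOnLattice        -- ★ `le_normAbs_of_not_mem_primePowBall` (discreteness of `‖·‖` off a ball)
import Literature.NumberTheory.Automorphic.LocalFieldHaarBalls                             -- ★ `normAbs_add_eq_of_lt` (+ ★ `TateLocalZetaShells`)
import HarnessLib

/-!
# Crux `HLiu418`, road `K2_Liu`, KIND 1 a♮ (the singular big-cell term), file (K1a-3)-S:
# THE ψ-TWISTED RANK-ONE STAGE — `∫ conj ψ(σx) · Φ_s(w₀ u(x) g) dμ(x)` is a FINITE coset sum of point values (no `L`-factor, no pole)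

Cell `hodgecm-mathlib`, crux item hLiu418 = `stmt-HodgeConjecture-24832`; squad K2 ∕ K2Liu; prover K2E3-p29 (g2) (LEAD F0P6-plan (g14) BATCH #87 (1),
line (K1a) of the KIND 1 a♮ census `K2/K2E5-p16/g8/CENSUS-K1a-GK.K2E5-p16-g8.md` §1∕§3, line lead K2E5-p16 (g8)).  THEOREMS ONLY (no `def`, no instance,
no notation, no named-fact hypothesis, no `sorry`); lane `--supports stmt-HodgeConjecture-24832` (count-neutral helper).  Abstract: a topological group `G`,
the local field `K_w`, an additive Haar measure `μ` — the letters of ★ B3 `K2LiuRankOneOperators` ∕ ★ B7-S `K2LiuRankOneStage` VERBATIM, plus an additive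
character `ψ` of `K_w` (★ Tate currency `AddChar K_w Circle`, `ψ.HasConductorExp mψ`) and a scalar `σ ≠ 0`.

THE POINT.  On the GK-cocycle road (★ B4d-3 `K2LiuSiegelIntertwiningCocycle`, ★ B7 `K2LiuA7NormalisedRegularityNonsplit`) the rank-one (corner-index) Fourier
coefficient of the Siegel big cell is the SAME three-stage chain as the intertwining operator `M_v(s) = A₂ A₁ A₂`, except that the LAST stage — the
innermost group letter `u_{2e₂}(ι x δ)`, the OUTER integral — carries the character `conj ψ_v(σ·x)` (census §1: «the twist sits on `b₁₁ = x`»).  An untwisted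
stage is `∫ Φ(w₀ u(x) g) dμ(x) = L(e − 1, ν) · N` (★ B7-S `exists_normalised_family`, the pole of KIND 0 at `s = ½` being `L_F(2s − 1)`); the TWISTED stage
has NO `L`-factor at all:
* §1 (any non-archimedean local field) — the two thresholds.  HEAD: if `ψ(σ·)` is trivial on `𝔭^m` then `x ↦ conj ψ(σx)·G(x)` is constant on the cosets
  of `𝔭^m` whenever `G` is (so ★ B5a `integrableOn_and_setIntegral_head_eq_sum` applies).  TAIL (`setIntegral_compl_twisted_eq_zero`): if off `𝔭^n` the integrand
  is `C·ν(x)⁻¹·‖x‖^{−e}·conj ψ(σx)` with `ν` invariant under `x ↦ x + t₀` there, for one `t₀ ∈ 𝔭^n` with `ψ(σ t₀) ≠ 1`, then `∫_{𝕜∖𝔭^n} = 0` — ONE additive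
  translation (★ F1 `setIntegral_eq_zero_of_translate`: `I = conj ψ(σt₀)·I`); `ν` may be RAMIFIED, no Gauss sum is evaluated.
* §2 (the rank-one letters of ★ B3 on `K_w`) — `integrable_and_integral_eq_twisted`: for `f` right-`K′`-invariant with the `SL₂` relation `hrel`, a level `m₀` at `y`,
  and a coset level `m ≥ m₀` past both thresholds (`ψ(σ𝔭^m) = 1`; some `t₀ ∈ 𝔭^{2m₀−m}` with `ψ(σt₀) ≠ 1`),
  `∫ conj ψ(σx) f(w₀ u(x) y) dμ(x) = Σ_{a∈R} μ(𝔭^m) · conj ψ(σa) · f(w₀ u(a) y)` (`R` representatives of `𝔭^{−m} ⧸ 𝔭^m`).  The `ν`-invariance needed by the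
  tail is DERIVED, not assumed: level-`m₀` invariance on the `m₀`-tail forces `ν ≡ 1` on `1 + 𝔭^{2m₀+1}` as soon as `C₀ f(y) ≠ 0` (and if `C₀ f(y) = 0` the tail
  integrand vanishes identically) — so NO continuity hypothesis on `ν` is added to ★ B3's letters.
* §3 — **`exists_twisted_family`**: the family form in the letters of ★ B7-S `exists_normalised_family` + `(ψ, hmψ, σ, hσ)`: an explicit `N : ℂ → G → ℂ`,
  `N s g = Σ_{a∈R(g)} μ(𝔭^{m(g)}) conj ψ(σa) Φ_s(w₀ u(a) g)` (per-point data chosen ONCE, `s`-free coefficients), with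
  `∫ conj ψ(σx) Φ_s(w₀ u(x) g) dμ(x) = N s g` and integrability on `1 < re s`, and — the pay-off — `s ↦ N s g` `q₀^{-s}`-rational and regular at EVERY `s₀`
  at which the point values `s ↦ Φ_s(g′)` are (no `L(e(s) − 1, ν)`, no `C₀`: the twisted stage contributes NO pole; KIND 1 a♮'s singular term is regular on
  all of `0 < re s` once stages A∕B are, census §1 «`L(2s,ε)`, `L(2s+1,ε)` cancel … `P°_v(σ; s−½)` a polynomial»).
HONEST LABEL.  `HC_CM` is proved only modulo the 7 printed citations (2 remaining named inputs: hLiu418 = `stmt-HodgeConjecture-24832`,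
h413 = `stmt-HodgeConjecture-24833`) until rung 0 closes; this file is a count-neutral helper and closes no socket.

## References
* [Casselman1980] W. Casselman, *The unramified principal series of p-adic groups I*, Compositio Math. 40 (1980), §3 Thm. 3.1 (rank-one operators, the cocycle).
* [CasselmanShalika1980] W. Casselman, J. Shalika, *The unramified principal series of p-adic groups II: the Whittaker function*, Compositio Math. 41 (1980), §2
  (the Whittaker functional along a rank-one step; vanishing of the far shells).
* [Tate1950] J. Tate, *Fourier analysis in number fields and Hecke's zeta-functions* (1950), §2.2, §2.5 (conductor of `ψ`, `∫_{𝔭^n} ψ(xy) dx`).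
* [KudlaRallis1994] S. Kudla, S. Rallis, Ann. of Math. 140 (1994), §2 (Fourier coefficients of the Siegel big cell, singular indices).
-/

set_option autoImplicit false
set_option linter.dupNamespace false -- the mandated namespace repeats `HodgeConjecture.HodgeConjecture`

noncomputable section

open MeasureTheory Filter Topology Set
open scoped NNReal ENNReal ComplexConjugate
open NumberField IsDedekindDomain
open Literature.NumberTheory.GaloisRepresentations.IsNonarchimedeanLocalField
open Literature.NumberTheory.Automorphic Literature.NumberTheory.Automorphic.LocalFieldHaar
open Summit.HodgeConjecture.HodgeConjecture.Cruxes.HLiu418.K2LiuQRationalDefs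
open Summit.HodgeConjecture.HodgeConjecture.Cruxes.HLiu418.K2LiuRankOneLevelShells
open Summit.HodgeConjecture.HodgeConjecture.Cruxes.HLiu418.K2LiuRankOneLevelHolomorphy
open Summit.HodgeConjecture.HodgeConjecture.Cruxes.HLiu418.K2LiuRankOneOperators
open Summit.HodgeConjecture.HodgeConjecture.Cruxes.HLiu418.K2LiuRankOneStage
open Summit.HodgeConjecture.HodgeConjecture.Cruxes.HLiu418.K2LiuShellVanishingByAveraging
open Summit.HodgeConjecture.HodgeConjecture.Cruxes.HLiu418.K2LiuAddCharTrivialOnLattice (le_normAbs_of_not_mem_primePowBall)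

namespace Summit.HodgeConjecture.HodgeConjecture.Cruxes.HLiu418.K2LiuRankOneStageTwisted

/-! ## §1 The two thresholds on a non-archimedean local field -/

section LocalField

variable {F : Type*} [Field F] [ValuativeRel F] [TopologicalSpace F] [IsNonarchimedeanLocalField F]

/-- `𝔭^n` is an additive subgroup: for `t ∈ 𝔭^n`, `x + t ∈ 𝔭^n ↔ x ∈ 𝔭^n`. [cite: Tate1950, §2.2] -/
theorem add_mem_primePowBall_iff_of_mem {n : ℤ} {t : F} (ht : t ∈ primePowBall F n) (x : F) :
    x + t ∈ primePowBall F n ↔ x ∈ primePowBall F n := by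
  refine ⟨fun h => ?_, fun h => add_mem_primePowBall h ht⟩
  have h' := add_mem_primePowBall h (neg_mem_primePowBall ht)
  rwa [add_neg_cancel_right] at h'

/-- Off `𝔭^n` a translation by `t ∈ 𝔭^n` does not change `‖·‖` (`‖t‖ ≤ (q⁻¹)^n < ‖x‖`, ultrametric equality). [cite: Tate1950, §2.2] -/
theorem normAbs_add_eq_of_not_mem {n : ℤ} {x t : F} (hx : x ∉ primePowBall F n) (ht : t ∈ primePowBall F n) :
    normAbs F (x + t) = normAbs F x := by
  rw [mem_primePowBall_iff, not_le] at hx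
  exact normAbs_add_eq_of_lt (lt_of_le_of_lt ht hx)

/-- Off `𝔭^n` every element is non-zero. [cite: Tate1950, §2.2] -/
theorem ne_zero_of_not_mem_primePowBall {n : ℤ} {x : F} (hx : x ∉ primePowBall F n) : x ≠ 0 := by
  rintro rfl
  exact hx (zero_mem_primePowBall n)

/-- **HEAD threshold.**  If `ψ(σ t) = 1` for all `t ∈ 𝔭^m` and `G` is constant on the cosets of `𝔭^m`, then so is `x ↦ conj ψ(σx) · G(x)`.
[cite: Tate1950, §2.5] [cite: CasselmanShalika1980, §2] -/
theorem twisted_const_on_cosets {ψ : AddChar F Circle} {σ : F} {m : ℤ} (hσm : ∀ t ∈ primePowBall F m, ψ (σ * t) = 1)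
    (G : F → ℂ) (hG : ∀ x : F, ∀ t ∈ primePowBall F m, G (x + t) = G x) (x : F) {t : F} (ht : t ∈ primePowBall F m) :
    conj ((ψ (σ * (x + t)) : ℂ)) * G (x + t) = conj ((ψ (σ * x)) : ℂ) * G x := by
  rw [hG x t ht, mul_add, AddChar.map_add_eq_mul, hσm t ht, mul_one]

variable [MeasurableSpace F] [BorelSpace F] (μ : Measure F) [μ.IsAddHaarMeasure]

/-- **TAIL threshold — the far part of a twisted rank-one integrand integrates to zero by ONE translation.**  Off `𝔭^n` let
`h(x) = C · ν(x)⁻¹ · ‖x‖^{−e} · conj ψ(σ x)`, and let `t₀ ∈ 𝔭^n` satisfy `ψ(σ t₀) ≠ 1` and leave `ν` invariant off `𝔭^n` (`ν(x + t₀) = ν(x)`).  Then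
`∫_{𝕜 ∖ 𝔭^n} h dμ = 0`: the substitution `x ↦ x + t₀` preserves `𝕜 ∖ 𝔭^n`, `‖·‖` and `ν` there and multiplies `h` by `conj ψ(σ t₀) ≠ 1` (★ F1
`setIntegral_eq_zero_of_translate`).  `ν` may be ramified; no Gauss sum is computed. [cite: Tate1950, §2.5] [cite: CasselmanShalika1980, §2] -/
theorem setIntegral_compl_twisted_eq_zero (n : ℤ) (h : F → ℂ) (ν : Fˣ →* ℂˣ) (C e : ℂ) {ψ : AddChar F Circle} (σ : F) {t₀ : F}
    (ht₀ : t₀ ∈ primePowBall F n) (hψt₀ : ψ (σ * t₀) ≠ 1)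
    (hν : ∀ (x : F) (hx : x ∉ primePowBall F n),
      ν (Units.mk0 (x + t₀) (ne_zero_of_not_mem_primePowBall fun h' => hx ((add_mem_primePowBall_iff_of_mem ht₀ x).1 h'))) =
        ν (Units.mk0 x (ne_zero_of_not_mem_primePowBall hx)))
    (htail : ∀ (x : F) (hx : x ∉ primePowBall F n),
      h x = C * (((ν (Units.mk0 x (ne_zero_of_not_mem_primePowBall hx)))⁻¹ : ℂˣ) : ℂ) * ((normAbs F x : ℝ) : ℂ) ^ (-e) *
        conj ((ψ (σ * x)) : ℂ)) :
    ∫ x in (primePowBall F n)ᶜ, h x ∂μ = 0 := by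
  have hζ : conj ((ψ (σ * t₀) : Circle) : ℂ) ≠ 1 := by
    intro h1
    apply hψt₀
    have h2 : ((ψ (σ * t₀) : Circle) : ℂ) = 1 := by
      have := congrArg conj h1
      simpa using this
    exact Circle.coe_eq_one.1 h2
  refine setIntegral_eq_zero_of_translate μ (measurableSet_primePowBall n).compl (t := t₀) (fun x => ?_) (fun x hx => ?_) hζ
  · simp only [Set.mem_compl_iff, add_mem_primePowBall_iff_of_mem ht₀ x]
  · have hx : x ∉ primePowBall F n := hx
    have hxt : x + t₀ ∉ primePowBall F n := fun h' => hx ((add_mem_primePowBall_iff_of_mem ht₀ x).1 h')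
    rw [htail (x + t₀) hxt, htail x hx, hν x hx, normAbs_add_eq_of_not_mem hx ht₀, mul_add, AddChar.map_add_eq_mul, Circle.coe_mul,
      map_mul]
    ring

end LocalField

/-! ## §2 The twisted rank-one stage at a completion `K_w`: value for a fixed function -/

section Fixed

variable {K : Type} [Field K] [NumberField K] {w : HeightOneSpectrum (𝓞 K)} {G : Type*} [Group G]

/-- **THE TAIL FORMULA at a level `m₀`** (as in ★ B3 `integrable_and_integral_eq`): off `𝔭^{−m₀}`, `x⁻¹ ∈ 𝔭^{m₀+1} ⊆ 𝔭^{m₀}`, so `ū(x⁻¹)` is absorbed by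
`K′` and the `SL₂` relation reads `f(w₀ u(x) y) = C₀ f(y) · ν(x)⁻¹ ‖x‖^{−e}`. [cite: Casselman1980, §3 Thm. 3.1] [cite: BushnellHenniart2006, §1.1] -/
theorem apply_eq_tail_of_level {f : G → ℂ} {K' : Subgroup G} (hfK : ∀ g, ∀ k ∈ K', f (g * k) = f g)
    {u ū : w.adicCompletion K → G} (w₀ : G) (ν : (w.adicCompletion K)ˣ →* ℂˣ) (e C₀ : ℂ)
    (hrel : ∀ (x : (w.adicCompletion K)ˣ) (g : G),
      f (w₀ * u x * g) = C₀ * (((ν x)⁻¹ : ℂˣ) : ℂ) * ((normAbs (w.adicCompletion K) (x : w.adicCompletion K) : ℝ) : ℂ) ^ (-e) *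
        f (ū ((x⁻¹ : (w.adicCompletion K)ˣ) : w.adicCompletion K) * g))
    (y : G) (m₀ : ℕ) (hmū : ∀ t ∈ primePowBall (w.adicCompletion K) (m₀ : ℤ), y⁻¹ * ū t * y ∈ K')
    (x : w.adicCompletion K) (hx : x ∉ primePowBall (w.adicCompletion K) (-(m₀ : ℤ))) :
    f (w₀ * u x * y) = C₀ * f y * ((((ν (Units.mk0 x (ne_zero_of_not_mem_primePowBall hx)))⁻¹ : ℂˣ) : ℂ) *
      ((normAbs (w.adicCompletion K) x : ℝ) : ℂ) ^ (-e)) := by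
  have hq0 : (0 : ℝ≥0) < (residueFieldCard (w.adicCompletion K) : ℝ≥0)⁻¹ := inv_residueFieldCard_pos
  set xu : (w.adicCompletion K)ˣ := Units.mk0 x (ne_zero_of_not_mem_primePowBall hx) with hxu
  have hxinv' : x⁻¹ ∈ primePowBall (w.adicCompletion K) (m₀ : ℤ) := by
    rw [mem_primePowBall_iff, map_inv₀]
    have hle := le_normAbs_of_not_mem_primePowBall hx
    have hx0 : (0 : ℝ≥0) < normAbs (w.adicCompletion K) x := (zpow_pos hq0 _).trans_le hle
    rw [inv_le_comm₀ hx0 (zpow_pos hq0 _), ← zpow_neg]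
    refine le_trans ?_ hle
    exact (zpow_le_zpow_iff_right_of_lt_one₀ hq0 inv_residueFieldCard_lt_one).2 (by omega)
  have hxinv : ((xu⁻¹ : (w.adicCompletion K)ˣ) : w.adicCompletion K) ∈ primePowBall (w.adicCompletion K) (m₀ : ℤ) := by
    rw [Units.val_inv_eq_inv_val]
    exact hxinv'
  have hk := hmū _ hxinv
  have h1 : ū ((xu⁻¹ : (w.adicCompletion K)ˣ) : w.adicCompletion K) * y =
      y * (y⁻¹ * ū ((xu⁻¹ : (w.adicCompletion K)ˣ) : w.adicCompletion K) * y) := by group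
  have hx' : (xu : w.adicCompletion K) = x := rfl
  rw [← hx', hrel xu y, h1, hfK _ _ hk]
  ring

/-- **LEVEL INVARIANCE ON THE TAIL FORCES A CONDUCTOR.**  In the letters of ★ B3 (`hrel`, right-`K′`-invariance, a level `m₀` at `y`): if
`C₀ · f(y) ≠ 0` then `ν(1 + z) = 1` for every `z ∈ 𝔭^{2m₀+1}` — take `x′` with `‖x′‖ = q^{m₀+1}` (off `𝔭^{−m₀}`) and `t′ := z x′ ∈ 𝔭^{m₀}`; the tail formula at
`x′` and at `x′ + t′` (same norm, `f(w₀u(x′+t′)y) = f(w₀u(x′)y)` by the level) gives `ν(x′ + t′) = ν(x′)`.  So NO continuity hypothesis on `ν` is needed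
below. [cite: Casselman1980, §3 Thm. 3.1] [cite: BushnellHenniart2006, §1.1] -/
theorem nu_one_add_eq_one_of_level {f : G → ℂ} {K' : Subgroup G} (hfK : ∀ g, ∀ k ∈ K', f (g * k) = f g)
    {u ū : w.adicCompletion K → G} (hu_add : ∀ x t, u (x + t) = u x * u t) (w₀ : G)
    (ν : (w.adicCompletion K)ˣ →* ℂˣ) (e C₀ : ℂ)
    (hrel : ∀ (x : (w.adicCompletion K)ˣ) (g : G),
      f (w₀ * u x * g) = C₀ * (((ν x)⁻¹ : ℂˣ) : ℂ) * ((normAbs (w.adicCompletion K) (x : w.adicCompletion K) : ℝ) : ℂ) ^ (-e) *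
        f (ū ((x⁻¹ : (w.adicCompletion K)ˣ) : w.adicCompletion K) * g))
    (y : G) (m₀ : ℕ) (hmu : ∀ t ∈ primePowBall (w.adicCompletion K) (m₀ : ℤ), y⁻¹ * u t * y ∈ K')
    (hmū : ∀ t ∈ primePowBall (w.adicCompletion K) (m₀ : ℤ), y⁻¹ * ū t * y ∈ K') (hC : C₀ * f y ≠ 0)
    (z : w.adicCompletion K) (hz : z ∈ primePowBall (w.adicCompletion K) (2 * (m₀ : ℤ) + 1)) (hz1 : (1 : w.adicCompletion K) + z ≠ 0) :
    ν (Units.mk0 (1 + z) hz1) = 1 := by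
  have hq0 : (0 : ℝ≥0) < (residueFieldCard (w.adicCompletion K) : ℝ≥0)⁻¹ := inv_residueFieldCard_pos
  have htail := apply_eq_tail_of_level hfK w₀ ν e C₀ hrel y m₀ hmū
  -- a point of norm exactly `q^{m₀+1}`
  obtain ⟨x', hx'0, hx'n⟩ := exists_normAbs_eq_inv_zpow_of_int (F := w.adicCompletion K) (-((m₀ : ℤ) + 1))
  have hx'out : x' ∉ primePowBall (w.adicCompletion K) (-(m₀ : ℤ)) := by
    rw [mem_primePowBall_iff, hx'n, not_le]
    exact (zpow_lt_zpow_iff_right_of_lt_one₀ hq0 inv_residueFieldCard_lt_one).2 (by omega)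
  -- `t' := z x' ∈ 𝔭^{m₀}`
  have ht' : z * x' ∈ primePowBall (w.adicCompletion K) (m₀ : ℤ) := by
    have h := mul_mem_primePowBall hz (le_of_eq hx'n : x' ∈ primePowBall (w.adicCompletion K) (-((m₀ : ℤ) + 1)))
    have heq : 2 * (m₀ : ℤ) + 1 + -((m₀ : ℤ) + 1) = (m₀ : ℤ) := by ring
    rwa [heq] at h
  have ht'neg : z * x' ∈ primePowBall (w.adicCompletion K) (-(m₀ : ℤ)) :=
    primePowBall_antitone (by omega) ht'
  have hx't'out : x' + z * x' ∉ primePowBall (w.adicCompletion K) (-(m₀ : ℤ)) := fun h' =>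
    hx'out ((add_mem_primePowBall_iff_of_mem ht'neg x').1 h')
  -- level invariance at `x'`
  have hlev : f (w₀ * u (x' + z * x') * y) = f (w₀ * u x' * y) := apply_mul_u_add hfK hu_add w₀ y hmu x' ht'
  rw [htail _ hx't'out, htail _ hx'out, normAbs_add_eq_of_not_mem hx'out ht'neg] at hlev
  -- cancel the non-zero scalars
  have hn0 : ((normAbs (w.adicCompletion K) x' : ℝ) : ℂ) ^ (-e) ≠ 0 := by
    have hpos : (0 : ℝ) < (normAbs (w.adicCompletion K) x' : ℝ) := by
      have : (0 : ℝ≥0) < normAbs (w.adicCompletion K) x' := by rw [hx'n]; exact zpow_pos hq0 _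
      exact_mod_cast this
    rw [Ne, Complex.cpow_eq_zero_iff, not_and_or]
    exact Or.inl (by exact_mod_cast hpos.ne')
  have hAB : (((ν (Units.mk0 (x' + z * x') (ne_zero_of_not_mem_primePowBall hx't'out)))⁻¹ : ℂˣ) : ℂ) =
      (((ν (Units.mk0 x' (ne_zero_of_not_mem_primePowBall hx'out)))⁻¹ : ℂˣ) : ℂ) :=
    mul_right_cancel₀ hn0 (mul_left_cancel₀ hC hlev)
  -- `ν(x' + t') = ν(x')` as units, and `(x' + t') = x' (1 + z)`
  have hunits : ν (Units.mk0 (x' + z * x') (ne_zero_of_not_mem_primePowBall hx't'out)) =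
      ν (Units.mk0 x' (ne_zero_of_not_mem_primePowBall hx'out)) :=
    inv_injective (Units.val_injective hAB)
  have hprod : Units.mk0 (x' + z * x') (ne_zero_of_not_mem_primePowBall hx't'out) =
      Units.mk0 x' (ne_zero_of_not_mem_primePowBall hx'out) * Units.mk0 (1 + z) hz1 := by
    ext; simp only [Units.val_mk0, Units.val_mul]; ring
  rw [hprod, map_mul] at hunits
  exact mul_eq_left.1 hunits

variable [MeasurableSpace (w.adicCompletion K)] [BorelSpace (w.adicCompletion K)] (μ : Measure (w.adicCompletion K)) [μ.IsAddHaarMeasure]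

/-- **THE VALUE OF THE TWISTED RANK-ONE STAGE (fixed function).**  In the letters of ★ B3 `integrable_and_integral_eq` (right-`K′`-invariant `f`, the `SL₂`
relation `hrel`, a level `m₀` at `y`, `x ↦ f(w₀ u(x) y)` integrable), an additive character `ψ`, a scalar `σ`, and a coset level `m ≥ m₀` past the two
thresholds — `ψ(σ·)` trivial on `𝔭^m` (HEAD) and non-trivial somewhere on `𝔭^{2m₀−m}` (TAIL) — with representatives `R` of `𝔭^{−m} ⧸ 𝔭^m`:
`x ↦ conj ψ(σx) · f(w₀ u(x) y)` is integrable and **`∫ conj ψ(σx) f(w₀ u(x) y) dμ(x) = Σ_{a∈R} μ(𝔭^m) · conj ψ(σa) · f(w₀ u(a) y)`** — the far part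
`𝕜 ∖ 𝔭^{−m}` contributes NOTHING (§1 TAIL with the conductor of §2, or the tail integrand is identically `0`). [cite: Casselman1980, §3 Thm. 3.1]
[cite: CasselmanShalika1980, §2] [cite: Tate1950, §2.5] -/
theorem integrable_and_integral_eq_twisted {f : G → ℂ} {K' : Subgroup G} (hfK : ∀ g, ∀ k ∈ K', f (g * k) = f g)
    {u ū : w.adicCompletion K → G} (hu_add : ∀ x t, u (x + t) = u x * u t) (w₀ : G)
    (ν : (w.adicCompletion K)ˣ →* ℂˣ) (e C₀ : ℂ)
    (hrel : ∀ (x : (w.adicCompletion K)ˣ) (g : G),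
      f (w₀ * u x * g) = C₀ * (((ν x)⁻¹ : ℂˣ) : ℂ) * ((normAbs (w.adicCompletion K) (x : w.adicCompletion K) : ℝ) : ℂ) ^ (-e) *
        f (ū ((x⁻¹ : (w.adicCompletion K)ˣ) : w.adicCompletion K) * g))
    (ψ : AddChar (w.adicCompletion K) Circle) (σ : w.adicCompletion K)
    (y : G) (m₀ m : ℕ) (hm : m₀ ≤ m)
    (hmu : ∀ t ∈ primePowBall (w.adicCompletion K) (m₀ : ℤ), y⁻¹ * u t * y ∈ K')
    (hmū : ∀ t ∈ primePowBall (w.adicCompletion K) (m₀ : ℤ), y⁻¹ * ū t * y ∈ K')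
    (hint₀ : Integrable (fun x => f (w₀ * u x * y)) μ)
    (hσm : ∀ t ∈ primePowBall (w.adicCompletion K) (m : ℤ), ψ (σ * t) = 1)
    (htail : ∃ t₀ ∈ primePowBall (w.adicCompletion K) (2 * (m₀ : ℤ) - m), ψ (σ * t₀) ≠ 1)
    (R : Finset (w.adicCompletion K))
    (hRinc : ∀ a ∈ R, ∀ a' ∈ R, a ≠ a' → a - a' ∉ primePowBall (w.adicCompletion K) (m : ℤ))
    (hRcov : primePowBall (w.adicCompletion K) (-(m : ℤ)) = ⋃ a ∈ R, {x | x - a ∈ primePowBall (w.adicCompletion K) (m : ℤ)}) :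
    Integrable (fun x => conj ((ψ (σ * x) : ℂ)) * f (w₀ * u x * y)) μ ∧
      ∫ x, conj ((ψ (σ * x) : ℂ)) * f (w₀ * u x * y) ∂μ =
        ∑ a ∈ R, (μ.real (primePowBall (w.adicCompletion K) (m : ℤ)) : ℂ) * (conj ((ψ (σ * a) : ℂ)) * f (w₀ * u a * y)) := by
  have hq0 : (0 : ℝ≥0) < (residueFieldCard (w.adicCompletion K) : ℝ≥0)⁻¹ := inv_residueFieldCard_pos
  set g : w.adicCompletion K → ℂ := fun x => conj ((ψ (σ * x) : ℂ)) * f (w₀ * u x * y) with hg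
  -- `f(w₀ u(·) y)` is constant on the cosets of `𝔭^{m₀}`, hence of `𝔭^m`; so is `g` (HEAD threshold)
  have hfconst : ∀ x : w.adicCompletion K, ∀ t ∈ primePowBall (w.adicCompletion K) (m : ℤ), f (w₀ * u (x + t) * y) = f (w₀ * u x * y) :=
    fun x t ht => apply_mul_u_add hfK hu_add w₀ y hmu x (primePowBall_antitone (by exact_mod_cast hm) ht)
  have hconst : ∀ x : w.adicCompletion K, ∀ t ∈ primePowBall (w.adicCompletion K) (m : ℤ), g (x + t) = g x :=
    fun x t ht => twisted_const_on_cosets hσm (fun x => f (w₀ * u x * y)) hfconst x ht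
  have hgm : AEStronglyMeasurable g μ := aestronglyMeasurable_of_forall_add_mem g m hconst
  -- integrability: same norm as the untwisted integrand
  have hnorm : ∀ x, ‖g x‖ ≤ ‖f (w₀ * u x * y)‖ := fun x => by
    simp only [hg, norm_mul, Complex.norm_conj, Circle.norm_coe, one_mul, le_refl]
  have hint : Integrable g μ := Integrable.mono' hint₀.norm hgm (Filter.Eventually.of_forall hnorm)
  -- HEAD: a finite coset sum
  have hhead : ∀ a ∈ R, ∀ x, x - a ∈ primePowBall (w.adicCompletion K) (m : ℤ) → g x = g a := by
    intro a _ x hx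
    have h := hconst a (x - a) hx
    rwa [add_sub_cancel] at h
  obtain ⟨-, hheadval⟩ := integrableOn_and_setIntegral_head_eq_sum μ R hRinc hRcov g hhead
  -- TAIL: zero
  have hsub : ∀ x : w.adicCompletion K, x ∉ primePowBall (w.adicCompletion K) (-(m : ℤ)) → x ∉ primePowBall (w.adicCompletion K) (-(m₀ : ℤ)) :=
    fun x hx hx' => hx (primePowBall_antitone (by omega) hx')
  have htailval : ∫ x in (primePowBall (w.adicCompletion K) (-(m : ℤ)))ᶜ, g x ∂μ = 0 := by
    obtain ⟨t₀, ht₀, hψt₀⟩ := htail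
    have ht₀' : t₀ ∈ primePowBall (w.adicCompletion K) (-(m : ℤ)) := primePowBall_antitone (by omega) ht₀
    by_cases hC : C₀ * f y = 0
    · -- the tail integrand vanishes identically
      refine (setIntegral_congr_fun (measurableSet_primePowBall _).compl (g := fun _ => (0 : ℂ)) fun x hx => ?_).trans
        (by simp)
      have hx : x ∉ primePowBall (w.adicCompletion K) (-(m : ℤ)) := hx
      show conj ((ψ (σ * x) : ℂ)) * f (w₀ * u x * y) = 0
      rw [apply_eq_tail_of_level hfK w₀ ν e C₀ hrel y m₀ hmū x (hsub x hx), hC, zero_mul, mul_zero]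
    · -- `ν` is invariant under `x ↦ x + t₀` off `𝔭^{-m}` (§2 conductor), and ONE translation kills the tail (§1)
      refine setIntegral_compl_twisted_eq_zero μ (-(m : ℤ)) g ν (C₀ * f y) e σ ht₀' hψt₀ (fun x hx => ?_) (fun x hx => ?_)
      · have hx0 : x ≠ 0 := ne_zero_of_not_mem_primePowBall hx
        -- `z := t₀ x⁻¹ ∈ 𝔭^{2m₀+1}`
        have hxinv : x⁻¹ ∈ primePowBall (w.adicCompletion K) ((m : ℤ) + 1) := by
          rw [mem_primePowBall_iff, map_inv₀]
          have hle := le_normAbs_of_not_mem_primePowBall hx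
          have hx0' : (0 : ℝ≥0) < normAbs (w.adicCompletion K) x := (zpow_pos hq0 _).trans_le hle
          rw [inv_le_comm₀ hx0' (zpow_pos hq0 _), ← zpow_neg]
          have heq : -((m : ℤ) + 1) = -(m : ℤ) - 1 := by ring
          rwa [heq]
        have hz : t₀ * x⁻¹ ∈ primePowBall (w.adicCompletion K) (2 * (m₀ : ℤ) + 1) := by
          have h := mul_mem_primePowBall ht₀ hxinv
          have heq : 2 * (m₀ : ℤ) - m + ((m : ℤ) + 1) = 2 * (m₀ : ℤ) + 1 := by ring
          rwa [heq] at h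
        have hz1 : (1 : w.adicCompletion K) + t₀ * x⁻¹ ≠ 0 := by
          intro h0
          have hneg : t₀ * x⁻¹ = -1 := by linear_combination h0
          have hle : normAbs (w.adicCompletion K) (t₀ * x⁻¹) ≤ (residueFieldCard (w.adicCompletion K) : ℝ≥0)⁻¹ ^ (2 * (m₀ : ℤ) + 1) := hz
          rw [hneg, normAbs_neg, map_one] at hle
          have hlt : (residueFieldCard (w.adicCompletion K) : ℝ≥0)⁻¹ ^ (2 * (m₀ : ℤ) + 1) < (residueFieldCard (w.adicCompletion K) : ℝ≥0)⁻¹ ^ (0 : ℤ) :=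
            (zpow_lt_zpow_iff_right_of_lt_one₀ hq0 inv_residueFieldCard_lt_one).2 (by omega)
          rw [zpow_zero] at hlt
          exact absurd (hle.trans_lt hlt) (lt_irrefl 1)
        have hν1 := nu_one_add_eq_one_of_level hfK hu_add w₀ ν e C₀ hrel y m₀ hmu hmū hC (t₀ * x⁻¹) hz hz1
        have hprod : Units.mk0 (x + t₀) (ne_zero_of_not_mem_primePowBall fun h' => hx ((add_mem_primePowBall_iff_of_mem ht₀' x).1 h')) =
            Units.mk0 x hx0 * Units.mk0 (1 + t₀ * x⁻¹) hz1 := by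
          ext
          simp only [Units.val_mk0, Units.val_mul]
          rw [mul_add, mul_one, mul_comm t₀ x⁻¹, ← mul_assoc, mul_inv_cancel₀ hx0, one_mul]
        rw [hprod, map_mul, hν1, mul_one]
      · show conj ((ψ (σ * x) : ℂ)) * f (w₀ * u x * y) = _
        rw [apply_eq_tail_of_level hfK w₀ ν e C₀ hrel y m₀ hmū x (hsub x hx)]
        ring
  refine ⟨hint, ?_⟩
  rw [← integral_add_compl (measurableSet_primePowBall (-(m : ℤ))) hint, hheadval, htailval, add_zero]

end Fixed

/-! ## §3 The twisted rank-one stage of a family: explicit, `s`-free coefficients, regular wherever the point values are -/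

section Family

variable {K : Type} [Field K] [NumberField K] {w : HeightOneSpectrum (𝓞 K)} {G : Type*} [Group G] [TopologicalSpace G] [IsTopologicalGroup G]
variable [MeasurableSpace (w.adicCompletion K)] [BorelSpace (w.adicCompletion K)] (μ : Measure (w.adicCompletion K)) [μ.IsAddHaarMeasure]

/-- **THE TWISTED RANK-ONE STAGE OF THE COCYCLE, FAMILY FORM.**  Letters of ★ B7-S `exists_normalised_family` VERBATIM (`Φ`, `K′`, `hΦK`, `u ū hu hu0 hū hū0 hu_add w₀`,
`ν hν`, `a c he C₀`, `hrel` on `1 < re s`), PLUS an additive character `ψ` of conductor exponent `mψ` and a scalar `σ ≠ 0`.  Then there is an EXPLICIT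
`N : ℂ → G → ℂ` — `N s g = Σ_{a ∈ R(g)} μ(𝔭^{m(g)}) · conj ψ(σa) · Φ_s(w₀ u(a) g)`, per-point data `(m(g), R(g))` chosen once — such that
(i) for EVERY `s₀` and `g`: if all point values `s ↦ Φ_s(g′)` are `q₀^{-s}`-rational and regular at `s₀`, so is `s ↦ N s g` (a finite sum with `s`-free
coefficients: NO `L(e(s) − 1, ν)`, `C₀` drops out — the twisted stage contributes NO pole); (ii) on `1 < re s`: `x ↦ conj ψ(σx) Φ_s(w₀ u(x) g)` is
integrable and **`∫ conj ψ(σx) · Φ_s(w₀ u(x) g) dμ(x) = N s g`**. [cite: Casselman1980, §3 Thm. 3.1] [cite: CasselmanShalika1980, §2] [cite: Tate1950, §2.5]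
[cite: KudlaRallis1994, §2] -/
theorem exists_twisted_family (Φ : ℂ → G → ℂ) {K' : Subgroup G} (hK' : IsOpen (K' : Set G))
    (hΦK : ∀ s : ℂ, 1 < s.re → ∀ g, ∀ k ∈ K', Φ s (g * k) = Φ s g)
    {u ū : w.adicCompletion K → G} (hu : Continuous u) (hu0 : u 0 = 1) (hū : Continuous ū) (hū0 : ū 0 = 1) (hu_add : ∀ x t, u (x + t) = u x * u t) (w₀ : G)
    (ν : (w.adicCompletion K)ˣ →* ℂˣ) (hν : ∀ x, ‖((ν x : ℂˣ) : ℂ)‖ = 1) (a : ℕ) (c : ℂ) (he : ∀ s : ℂ, 1 < s.re → 1 < ((a : ℂ) * s + c).re)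
    (C₀ : ℂ → ℂ)
    (hrel : ∀ s : ℂ, 1 < s.re → ∀ (x : (w.adicCompletion K)ˣ) (g : G),
      Φ s (w₀ * u x * g) = C₀ s * (((ν x)⁻¹ : ℂˣ) : ℂ) * ((normAbs (w.adicCompletion K) (x : w.adicCompletion K) : ℝ) : ℂ) ^ (-((a : ℂ) * s + c)) *
        Φ s (ū ((x⁻¹ : (w.adicCompletion K)ˣ) : w.adicCompletion K) * g))
    (ψ : AddChar (w.adicCompletion K) Circle) {mψ : ℤ} (hmψ : ψ.HasConductorExp mψ) {σ : w.adicCompletion K} (hσ : σ ≠ 0) :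
    ∃ N : ℂ → G → ℂ,
      (∀ (q₀ : ℕ) (s₀ : ℂ) (g : G), (∀ g' : G, IsQRationalRegularAt q₀ s₀ fun s => Φ s g') → IsQRationalRegularAt q₀ s₀ fun s => N s g) ∧
      ∀ s : ℂ, 1 < s.re → ∀ g,
        Integrable (fun x => conj ((ψ (σ * x) : ℂ)) * Φ s (w₀ * u x * g)) μ ∧
          ∫ x, conj ((ψ (σ * x) : ℂ)) * Φ s (w₀ * u x * g) ∂μ = N s g := by
  have hq0 : (0 : ℝ≥0) < (residueFieldCard (w.adicCompletion K) : ℝ≥0)⁻¹ := inv_residueFieldCard_pos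
  -- `‖σ‖ = (q⁻¹)^j`
  obtain ⟨j, hj⟩ := exists_normAbs_eq_inv_zpow hσ
  -- the level at each point, chosen once
  choose m₀ hmu hmū using fun g => exists_level₂ u ū hu hu0 hū hū0 K' hK' g
  -- the coset level: past the level, past the HEAD threshold `mψ − j`, past the TAIL threshold `j − mψ + 2 m₀ + 1`
  let m : G → ℕ := fun g => max (m₀ g) (max (mψ - j).toNat (j - mψ + 2 * (m₀ g) + 1).toNat)
  have hm₀m : ∀ g, m₀ g ≤ m g := fun g => le_max_left _ _
  have hmhead : ∀ g, mψ - j ≤ (m g : ℤ) := fun g => by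
    have h1 : ((mψ - j).toNat : ℤ) ≤ (m g : ℤ) := by exact_mod_cast (le_max_left _ _).trans (le_max_right (m₀ g) _)
    exact (Int.self_le_toNat _).trans h1
  have hmtail : ∀ g, j - mψ + 2 * (m₀ g : ℤ) + 1 ≤ (m g : ℤ) := fun g => by
    have h1 : ((j - mψ + 2 * (m₀ g : ℤ) + 1).toNat : ℤ) ≤ (m g : ℤ) := by
      exact_mod_cast (le_max_right _ _).trans (le_max_right (m₀ g) _)
    exact (Int.self_le_toNat _).trans h1
  -- representatives of `𝔭^{-m(g)} ⧸ 𝔭^{m(g)}`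
  have hR : ∀ g : G, ∃ R : Finset (w.adicCompletion K),
      (∀ a₁ ∈ R, ∀ a₂ ∈ R, a₁ ≠ a₂ → a₁ - a₂ ∉ primePowBall (w.adicCompletion K) (m g : ℤ)) ∧
      primePowBall (w.adicCompletion K) (-(m g : ℤ)) = ⋃ a₁ ∈ R, {x | x - a₁ ∈ primePowBall (w.adicCompletion K) (m g : ℤ)} := fun g => by
    obtain ⟨R, -, hRinc, hRcov⟩ := exists_finset_primePowBall_eq_biUnion (F := w.adicCompletion K) (j := -(m g : ℤ)) (r := (m g : ℤ)) (by omega)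
    exact ⟨R, hRinc, hRcov⟩
  choose R hRinc hRcov using hR
  -- the two thresholds
  have hσm : ∀ g, ∀ t ∈ primePowBall (w.adicCompletion K) (m g : ℤ), ψ (σ * t) = 1 := fun g t ht => by
    refine hmψ.1 _ ((mul_mem_primePowBall_iff hj).2 (primePowBall_antitone ?_ ht))
    linarith [hmhead g]
  have htail : ∀ g, ∃ t₀ ∈ primePowBall (w.adicCompletion K) (2 * (m₀ g : ℤ) - m g), ψ (σ * t₀) ≠ 1 := fun g => by
    have hσout : σ ∉ primePowBall (w.adicCompletion K) (mψ - (2 * (m₀ g : ℤ) - m g)) := by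
      rw [mem_primePowBall_iff, hj, not_le]
      exact (zpow_lt_zpow_iff_right_of_lt_one₀ hq0 inv_residueFieldCard_lt_one).2 (by linarith [hmtail g])
    obtain ⟨t₀, ht₀, hne⟩ := exists_mem_primePowBall_addChar_mul_ne_one hmψ hσout
    exact ⟨t₀, ht₀, by rwa [mul_comm] at hne⟩
  refine ⟨fun s g => ∑ a₁ ∈ R g, (μ.real (primePowBall (w.adicCompletion K) (m g : ℤ)) : ℂ) * (conj ((ψ (σ * a₁) : ℂ)) * Φ s (w₀ * u a₁ * g)),
    fun q₀ s₀ g hreg => ?_, fun s hs g => ?_⟩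
  · exact IsQRationalRegularAt.sum (R g) fun a₁ _ => ((hreg (w₀ * u a₁ * g)).const_mul _).const_mul _
  · have hint₀ : Integrable (fun x => Φ s (w₀ * u x * g)) μ :=
      integrable_of_letters μ hK' (hΦK s hs) hu hu0 hū hū0 hu_add w₀ ν hν _ (C₀ s) (he s hs) (hrel s hs) g
    exact integrable_and_integral_eq_twisted μ (hΦK s hs) hu_add w₀ ν _ (C₀ s) (hrel s hs) ψ σ g (m₀ g) (m g) (hm₀m g)
      (hmu g) (hmū g) hint₀ (hσm g) (htail g) (R g) (hRinc g) (hRcov g)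

end Family

end Summit.HodgeConjecture.HodgeConjecture.Cruxes.HLiu418.K2LiuRankOneStageTwisted

end
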